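import Summits.ResolutionOfSingularities.ResolutionOfSingularities.Theorems.FrobeniusLadderFInjectiveMacaulayficationRMonoidStraightening
import HarnessLib

/-!
# T-TOR IN-HOUSE for the recurrent-monoid bed, (FREE′) half 1 (continued): SPANNING — every monomial of `k[R]` lies in `Σᵢ k[θ] · bElem i`
# (crux `FInjectiveMacaulayfication` stmt-ResolutionOfSingularities-15315, chain w45a; res-L1-w45a-plan-1 R23.13 (2) + GO 06:28:28Z «(CM) = (FREE′)»;
# seat res-L1-w45a-lead-1 g13; data `…RMonoidFreeDefs`, identities `…RMonoidStraightening`)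

[OURS · L1 W4.5a] Support file (`--supports stmt-ResolutionOfSingularities-15315 --as helper`); def-free; UNCONDITIONAL; no named fact; NOT a statement
of any manuscript; replaces the role of NO printed item. AI-written (AI review is weaker than expert review). Nothing of the crux is proved here.

With `M_t := span_k {θ^a · bElem i : |a| + bDeg i = t} ⊆ k[R]` (written inline):
* §4 `thetaPow_mul_mem` — `θ^a · M_s ⊆ M_{s+|a|}`;
* §5 the 35 straightening identities of `…RMonoidStraightening` as memberships `bElem i · symElem j ∈ M_{bDeg i + 1}` (`mem_i_j`, dispatcher `mem_base`),
  and `mul_symElem_mem` — `M_t · symElem j ⊆ M_{t+1}`;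
* §6 ★★ `wordElem_wordOf_mem` — EVERY monomial `wordElem (wordOf m)` of degree `t = Σ m` lies in `M_t` (induction on `t`: peel one symbol, straighten).
  So `k[R] = Σᵢ k[θ] · bElem i`: the SPANNING half of «`B` is a `k[θ]`-basis of `k[R]`» (linear independence: `…RMonoidFreeBasis`).
[folklore; cite: BrunsHerzog1998, Thm. 2.1.2 (context: Hironaka's criterion)]
-/

-- single-problem summit: the doubled namespace component is forced
set_option linter.dupNamespace false

noncomputable section

open MvPolynomial

namespace Summit.ResolutionOfSingularities.ResolutionOfSingularities.Theorems.FInjectiveMacaulayfication.RMonoidSpanning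

open Summit.ResolutionOfSingularities.ResolutionOfSingularities.Theorems.FInjectiveMacaulayfication RMonoidFreeDefs RMonoidStraightening
open Summit.ResolutionOfSingularities.ResolutionOfSingularities.Theorems.WildQuotientResolution.ToricChart

variable (k : Type) [Field k]

/-! ## §4 `θ^a · M_s ⊆ M_{s + |a|}` -/

/-- Multiplying `M_s` by `θ^a` lands in `M_{s+|a|}`. [plumbing] -/
theorem thetaPow_mul_mem (a : Fin 4 → ℕ) (s : ℕ) {x : Ring k PEmpty RMonoidDefs.rDatum}
    (hx : x ∈ Submodule.span k {x | ∃ (i : Fin 5) (b : Fin 4 → ℕ), (∑ u, b u) + bDeg i = s ∧ x = thetaPow k b * bElem k i}) :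
    thetaPow k a * x ∈ Submodule.span k
      {x | ∃ (i : Fin 5) (b : Fin 4 → ℕ), (∑ u, b u) + bDeg i = s + ∑ u, a u ∧ x = thetaPow k b * bElem k i} := by
  induction hx using Submodule.span_induction with
  | mem x hx =>
    obtain ⟨i, b, hb, rfl⟩ := hx
    rw [← mul_assoc, ← thetaPow_add]
    refine Submodule.subset_span ⟨i, a + b, ?_, rfl⟩
    rw [← hb]
    simp only [Pi.add_apply, Finset.sum_add_distrib]
    ring
  | zero => rw [mul_zero]; exact Submodule.zero_mem _
  | add x y _ _ hx hy => rw [mul_add]; exact Submodule.add_mem _ hx hy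
  | smul c x _ hx => rw [mul_smul_comm]; exact Submodule.smul_mem _ c hx

/-! ## §5 The 35 identities as memberships `bElem i · symElem j ∈ M (bDeg i + 1)` -/

/-- Membership form of `straight_0_0`. [plumbing] -/
theorem mem_0_0 : bElem k 0 * symElem k 0 ∈ Submodule.span k
    {x | ∃ (i' : Fin 5) (a : Fin 4 → ℕ), (∑ s, a s) + bDeg i' = bDeg 0 + 1 ∧ x = thetaPow k a * bElem k i'} := by
  rw [straight_0_0]
  exact (Submodule.sub_mem _ (gen_mem k 0 ![1, 0, 0, 0] (bDeg 0 + 1) (by decide)) (gen_mem k 2 ![0, 0, 0, 0] (bDeg 0 + 1) (by decide)))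

/-- Membership form of `straight_0_1`. [plumbing] -/
theorem mem_0_1 : bElem k 0 * symElem k 1 ∈ Submodule.span k
    {x | ∃ (i' : Fin 5) (a : Fin 4 → ℕ), (∑ s, a s) + bDeg i' = bDeg 0 + 1 ∧ x = thetaPow k a * bElem k i'} := by
  rw [straight_0_1]
  exact (Submodule.sub_mem _ (gen_mem k 0 ![0, 1, 0, 0] (bDeg 0 + 1) (by decide)) (gen_mem k 4 ![0, 0, 0, 0] (bDeg 0 + 1) (by decide)))

/-- Membership form of `straight_0_2`. [plumbing] -/
theorem mem_0_2 : bElem k 0 * symElem k 2 ∈ Submodule.span k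
    {x | ∃ (i' : Fin 5) (a : Fin 4 → ℕ), (∑ s, a s) + bDeg i' = bDeg 0 + 1 ∧ x = thetaPow k a * bElem k i'} := by
  rw [straight_0_2]
  exact (Submodule.sub_mem _ (gen_mem k 0 ![0, 0, 1, 0] (bDeg 0 + 1) (by decide)) (gen_mem k 1 ![0, 0, 0, 0] (bDeg 0 + 1) (by decide)))

/-- Membership form of `straight_0_3`. [plumbing] -/
theorem mem_0_3 : bElem k 0 * symElem k 3 ∈ Submodule.span k
    {x | ∃ (i' : Fin 5) (a : Fin 4 → ℕ), (∑ s, a s) + bDeg i' = bDeg 0 + 1 ∧ x = thetaPow k a * bElem k i'} := by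
  rw [straight_0_3]
  exact (gen_mem k 2 ![0, 0, 0, 0] (bDeg 0 + 1) (by decide))

/-- Membership form of `straight_0_4`. [plumbing] -/
theorem mem_0_4 : bElem k 0 * symElem k 4 ∈ Submodule.span k
    {x | ∃ (i' : Fin 5) (a : Fin 4 → ℕ), (∑ s, a s) + bDeg i' = bDeg 0 + 1 ∧ x = thetaPow k a * bElem k i'} := by
  rw [straight_0_4]
  exact (gen_mem k 4 ![0, 0, 0, 0] (bDeg 0 + 1) (by decide))

/-- Membership form of `straight_0_5`. [plumbing] -/
theorem mem_0_5 : bElem k 0 * symElem k 5 ∈ Submodule.span k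
    {x | ∃ (i' : Fin 5) (a : Fin 4 → ℕ), (∑ s, a s) + bDeg i' = bDeg 0 + 1 ∧ x = thetaPow k a * bElem k i'} := by
  rw [straight_0_5]
  exact (gen_mem k 0 ![0, 0, 0, 1] (bDeg 0 + 1) (by decide))

/-- Membership form of `straight_0_6`. [plumbing] -/
theorem mem_0_6 : bElem k 0 * symElem k 6 ∈ Submodule.span k
    {x | ∃ (i' : Fin 5) (a : Fin 4 → ℕ), (∑ s, a s) + bDeg i' = bDeg 0 + 1 ∧ x = thetaPow k a * bElem k i'} := by
  rw [straight_0_6]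
  exact (gen_mem k 1 ![0, 0, 0, 0] (bDeg 0 + 1) (by decide))

/-- Membership form of `straight_1_0`. [plumbing] -/
theorem mem_1_0 : bElem k 1 * symElem k 0 ∈ Submodule.span k
    {x | ∃ (i' : Fin 5) (a : Fin 4 → ℕ), (∑ s, a s) + bDeg i' = bDeg 1 + 1 ∧ x = thetaPow k a * bElem k i'} := by
  rw [straight_1_0]
  exact (Submodule.sub_mem _ (gen_mem k 1 ![1, 0, 0, 0] (bDeg 1 + 1) (by decide)) (gen_mem k 3 ![0, 0, 0, 0] (bDeg 1 + 1) (by decide)))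

/-- Membership form of `straight_1_1`. [plumbing] -/
theorem mem_1_1 : bElem k 1 * symElem k 1 ∈ Submodule.span k
    {x | ∃ (i' : Fin 5) (a : Fin 4 → ℕ), (∑ s, a s) + bDeg i' = bDeg 1 + 1 ∧ x = thetaPow k a * bElem k i'} := by
  rw [straight_1_1]
  exact (Submodule.sub_mem _ (gen_mem k 1 ![0, 1, 0, 0] (bDeg 1 + 1) (by decide)) (gen_mem k 2 ![0, 0, 0, 1] (bDeg 1 + 1) (by decide)))

/-- Membership form of `straight_1_2`. [plumbing] -/
theorem mem_1_2 : bElem k 1 * symElem k 2 ∈ Submodule.span k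
    {x | ∃ (i' : Fin 5) (a : Fin 4 → ℕ), (∑ s, a s) + bDeg i' = bDeg 1 + 1 ∧ x = thetaPow k a * bElem k i'} := by
  rw [straight_1_2]
  exact (Submodule.sub_mem _ (gen_mem k 0 ![0, 1, 0, 1] (bDeg 1 + 1) (by decide)) (gen_mem k 4 ![0, 0, 0, 1] (bDeg 1 + 1) (by decide)))

/-- Membership form of `straight_1_3`. [plumbing] -/
theorem mem_1_3 : bElem k 1 * symElem k 3 ∈ Submodule.span k
    {x | ∃ (i' : Fin 5) (a : Fin 4 → ℕ), (∑ s, a s) + bDeg i' = bDeg 1 + 1 ∧ x = thetaPow k a * bElem k i'} := by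
  rw [straight_1_3]
  exact (gen_mem k 3 ![0, 0, 0, 0] (bDeg 1 + 1) (by decide))

/-- Membership form of `straight_1_4`. [plumbing] -/
theorem mem_1_4 : bElem k 1 * symElem k 4 ∈ Submodule.span k
    {x | ∃ (i' : Fin 5) (a : Fin 4 → ℕ), (∑ s, a s) + bDeg i' = bDeg 1 + 1 ∧ x = thetaPow k a * bElem k i'} := by
  rw [straight_1_4]
  exact (gen_mem k 2 ![0, 0, 0, 1] (bDeg 1 + 1) (by decide))

/-- Membership form of `straight_1_5`. [plumbing] -/
theorem mem_1_5 : bElem k 1 * symElem k 5 ∈ Submodule.span k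
    {x | ∃ (i' : Fin 5) (a : Fin 4 → ℕ), (∑ s, a s) + bDeg i' = bDeg 1 + 1 ∧ x = thetaPow k a * bElem k i'} := by
  rw [straight_1_5]
  exact (gen_mem k 1 ![0, 0, 0, 1] (bDeg 1 + 1) (by decide))

/-- Membership form of `straight_1_6`. [plumbing] -/
theorem mem_1_6 : bElem k 1 * symElem k 6 ∈ Submodule.span k
    {x | ∃ (i' : Fin 5) (a : Fin 4 → ℕ), (∑ s, a s) + bDeg i' = bDeg 1 + 1 ∧ x = thetaPow k a * bElem k i'} := by
  rw [straight_1_6]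
  exact (Submodule.add_mem _ (Submodule.add_mem _ (Submodule.neg_mem _ (gen_mem k 0 ![0, 1, 0, 1] (bDeg 1 + 1) (by decide))) (gen_mem k 1 ![0, 0, 1, 0] (bDeg 1 + 1) (by decide))) (gen_mem k 4 ![0, 0, 0, 1] (bDeg 1 + 1) (by decide)))

/-- Membership form of `straight_2_0`. [plumbing] -/
theorem mem_2_0 : bElem k 2 * symElem k 0 ∈ Submodule.span k
    {x | ∃ (i' : Fin 5) (a : Fin 4 → ℕ), (∑ s, a s) + bDeg i' = bDeg 2 + 1 ∧ x = thetaPow k a * bElem k i'} := by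
  rw [straight_2_0]
  exact (Submodule.sub_mem _ (gen_mem k 0 ![0, 1, 0, 1] (bDeg 2 + 1) (by decide)) (gen_mem k 4 ![0, 0, 0, 1] (bDeg 2 + 1) (by decide)))

/-- Membership form of `straight_2_1`. [plumbing] -/
theorem mem_2_1 : bElem k 2 * symElem k 1 ∈ Submodule.span k
    {x | ∃ (i' : Fin 5) (a : Fin 4 → ℕ), (∑ s, a s) + bDeg i' = bDeg 2 + 1 ∧ x = thetaPow k a * bElem k i'} := by
  rw [straight_2_1]
  exact (Submodule.sub_mem _ (Submodule.add_mem _ (Submodule.sub_mem _ (gen_mem k 0 ![0, 0, 1, 1] (bDeg 2 + 1) (by decide)) (gen_mem k 1 ![0, 0, 0, 1] (bDeg 2 + 1) (by decide))) (gen_mem k 2 ![0, 1, 0, 0] (bDeg 2 + 1) (by decide))) (gen_mem k 4 ![1, 0, 0, 0] (bDeg 2 + 1) (by decide)))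

/-- Membership form of `straight_2_2`. [plumbing] -/
theorem mem_2_2 : bElem k 2 * symElem k 2 ∈ Submodule.span k
    {x | ∃ (i' : Fin 5) (a : Fin 4 → ℕ), (∑ s, a s) + bDeg i' = bDeg 2 + 1 ∧ x = thetaPow k a * bElem k i'} := by
  rw [straight_2_2]
  exact (Submodule.sub_mem _ (gen_mem k 2 ![0, 0, 1, 0] (bDeg 2 + 1) (by decide)) (gen_mem k 3 ![0, 0, 0, 0] (bDeg 2 + 1) (by decide)))

/-- Membership form of `straight_2_3`. [plumbing] -/
theorem mem_2_3 : bElem k 2 * symElem k 3 ∈ Submodule.span k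
    {x | ∃ (i' : Fin 5) (a : Fin 4 → ℕ), (∑ s, a s) + bDeg i' = bDeg 2 + 1 ∧ x = thetaPow k a * bElem k i'} := by
  rw [straight_2_3]
  exact (Submodule.add_mem _ (Submodule.add_mem _ (Submodule.neg_mem _ (gen_mem k 0 ![0, 1, 0, 1] (bDeg 2 + 1) (by decide))) (gen_mem k 2 ![1, 0, 0, 0] (bDeg 2 + 1) (by decide))) (gen_mem k 4 ![0, 0, 0, 1] (bDeg 2 + 1) (by decide)))

/-- Membership form of `straight_2_4`. [plumbing] -/
theorem mem_2_4 : bElem k 2 * symElem k 4 ∈ Submodule.span k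
    {x | ∃ (i' : Fin 5) (a : Fin 4 → ℕ), (∑ s, a s) + bDeg i' = bDeg 2 + 1 ∧ x = thetaPow k a * bElem k i'} := by
  rw [straight_2_4]
  exact (Submodule.add_mem _ (Submodule.add_mem _ (Submodule.neg_mem _ (gen_mem k 0 ![0, 0, 1, 1] (bDeg 2 + 1) (by decide))) (gen_mem k 1 ![0, 0, 0, 1] (bDeg 2 + 1) (by decide))) (gen_mem k 4 ![1, 0, 0, 0] (bDeg 2 + 1) (by decide)))

/-- Membership form of `straight_2_5`. [plumbing] -/
theorem mem_2_5 : bElem k 2 * symElem k 5 ∈ Submodule.span k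
    {x | ∃ (i' : Fin 5) (a : Fin 4 → ℕ), (∑ s, a s) + bDeg i' = bDeg 2 + 1 ∧ x = thetaPow k a * bElem k i'} := by
  rw [straight_2_5]
  exact (gen_mem k 2 ![0, 0, 0, 1] (bDeg 2 + 1) (by decide))

/-- Membership form of `straight_2_6`. [plumbing] -/
theorem mem_2_6 : bElem k 2 * symElem k 6 ∈ Submodule.span k
    {x | ∃ (i' : Fin 5) (a : Fin 4 → ℕ), (∑ s, a s) + bDeg i' = bDeg 2 + 1 ∧ x = thetaPow k a * bElem k i'} := by
  rw [straight_2_6]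
  exact (gen_mem k 3 ![0, 0, 0, 0] (bDeg 2 + 1) (by decide))

/-- Membership form of `straight_3_0`. [plumbing] -/
theorem mem_3_0 : bElem k 3 * symElem k 0 ∈ Submodule.span k
    {x | ∃ (i' : Fin 5) (a : Fin 4 → ℕ), (∑ s, a s) + bDeg i' = bDeg 3 + 1 ∧ x = thetaPow k a * bElem k i'} := by
  rw [straight_3_0]
  exact (Submodule.sub_mem _ (gen_mem k 1 ![0, 1, 0, 1] (bDeg 3 + 1) (by decide)) (gen_mem k 2 ![0, 0, 0, 2] (bDeg 3 + 1) (by decide)))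

/-- Membership form of `straight_3_1`. [plumbing] -/
theorem mem_3_1 : bElem k 3 * symElem k 1 ∈ Submodule.span k
    {x | ∃ (i' : Fin 5) (a : Fin 4 → ℕ), (∑ s, a s) + bDeg i' = bDeg 3 + 1 ∧ x = thetaPow k a * bElem k i'} := by
  rw [straight_3_1]
  exact (Submodule.sub_mem _ (Submodule.add_mem _ (Submodule.sub_mem _ (gen_mem k 0 ![0, 1, 0, 2] (bDeg 3 + 1) (by decide)) (gen_mem k 2 ![1, 0, 0, 1] (bDeg 3 + 1) (by decide))) (gen_mem k 3 ![0, 1, 0, 0] (bDeg 3 + 1) (by decide))) (gen_mem k 4 ![0, 0, 0, 2] (bDeg 3 + 1) (by decide)))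

/-- Membership form of `straight_3_2`. [plumbing] -/
theorem mem_3_2 : bElem k 3 * symElem k 2 ∈ Submodule.span k
    {x | ∃ (i' : Fin 5) (a : Fin 4 → ℕ), (∑ s, a s) + bDeg i' = bDeg 3 + 1 ∧ x = thetaPow k a * bElem k i'} := by
  rw [straight_3_2]
  exact (Submodule.sub_mem _ (Submodule.add_mem _ (Submodule.sub_mem _ (gen_mem k 0 ![0, 0, 1, 2] (bDeg 3 + 1) (by decide)) (gen_mem k 1 ![0, 0, 0, 2] (bDeg 3 + 1) (by decide))) (gen_mem k 2 ![0, 1, 0, 1] (bDeg 3 + 1) (by decide))) (gen_mem k 4 ![1, 0, 0, 1] (bDeg 3 + 1) (by decide)))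

/-- Membership form of `straight_3_3`. [plumbing] -/
theorem mem_3_3 : bElem k 3 * symElem k 3 ∈ Submodule.span k
    {x | ∃ (i' : Fin 5) (a : Fin 4 → ℕ), (∑ s, a s) + bDeg i' = bDeg 3 + 1 ∧ x = thetaPow k a * bElem k i'} := by
  rw [straight_3_3]
  exact (Submodule.add_mem _ (Submodule.add_mem _ (Submodule.neg_mem _ (gen_mem k 1 ![0, 1, 0, 1] (bDeg 3 + 1) (by decide))) (gen_mem k 2 ![0, 0, 0, 2] (bDeg 3 + 1) (by decide))) (gen_mem k 3 ![1, 0, 0, 0] (bDeg 3 + 1) (by decide)))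

/-- Membership form of `straight_3_4`. [plumbing] -/
theorem mem_3_4 : bElem k 3 * symElem k 4 ∈ Submodule.span k
    {x | ∃ (i' : Fin 5) (a : Fin 4 → ℕ), (∑ s, a s) + bDeg i' = bDeg 3 + 1 ∧ x = thetaPow k a * bElem k i'} := by
  rw [straight_3_4]
  exact (Submodule.add_mem _ (Submodule.add_mem _ (Submodule.neg_mem _ (gen_mem k 0 ![0, 1, 0, 2] (bDeg 3 + 1) (by decide))) (gen_mem k 2 ![1, 0, 0, 1] (bDeg 3 + 1) (by decide))) (gen_mem k 4 ![0, 0, 0, 2] (bDeg 3 + 1) (by decide)))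

/-- Membership form of `straight_3_5`. [plumbing] -/
theorem mem_3_5 : bElem k 3 * symElem k 5 ∈ Submodule.span k
    {x | ∃ (i' : Fin 5) (a : Fin 4 → ℕ), (∑ s, a s) + bDeg i' = bDeg 3 + 1 ∧ x = thetaPow k a * bElem k i'} := by
  rw [straight_3_5]
  exact (gen_mem k 3 ![0, 0, 0, 1] (bDeg 3 + 1) (by decide))

/-- Membership form of `straight_3_6`. [plumbing] -/
theorem mem_3_6 : bElem k 3 * symElem k 6 ∈ Submodule.span k
    {x | ∃ (i' : Fin 5) (a : Fin 4 → ℕ), (∑ s, a s) + bDeg i' = bDeg 3 + 1 ∧ x = thetaPow k a * bElem k i'} := by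
  rw [straight_3_6]
  exact (Submodule.add_mem _ (Submodule.add_mem _ (Submodule.sub_mem _ (Submodule.add_mem _ (Submodule.neg_mem _ (gen_mem k 0 ![0, 0, 1, 2] (bDeg 3 + 1) (by decide))) (gen_mem k 1 ![0, 0, 0, 2] (bDeg 3 + 1) (by decide))) (gen_mem k 2 ![0, 1, 0, 1] (bDeg 3 + 1) (by decide))) (gen_mem k 3 ![0, 0, 1, 0] (bDeg 3 + 1) (by decide))) (gen_mem k 4 ![1, 0, 0, 1] (bDeg 3 + 1) (by decide)))

/-- Membership form of `straight_4_0`. [plumbing] -/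
theorem mem_4_0 : bElem k 4 * symElem k 0 ∈ Submodule.span k
    {x | ∃ (i' : Fin 5) (a : Fin 4 → ℕ), (∑ s, a s) + bDeg i' = bDeg 4 + 1 ∧ x = thetaPow k a * bElem k i'} := by
  rw [straight_4_0]
  exact (Submodule.sub_mem _ (gen_mem k 0 ![0, 0, 1, 1] (bDeg 4 + 1) (by decide)) (gen_mem k 1 ![0, 0, 0, 1] (bDeg 4 + 1) (by decide)))

/-- Membership form of `straight_4_1`. [plumbing] -/
theorem mem_4_1 : bElem k 4 * symElem k 1 ∈ Submodule.span k
    {x | ∃ (i' : Fin 5) (a : Fin 4 → ℕ), (∑ s, a s) + bDeg i' = bDeg 4 + 1 ∧ x = thetaPow k a * bElem k i'} := by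
  rw [straight_4_1]
  exact (Submodule.sub_mem _ (gen_mem k 2 ![0, 0, 1, 0] (bDeg 4 + 1) (by decide)) (gen_mem k 3 ![0, 0, 0, 0] (bDeg 4 + 1) (by decide)))

/-- Membership form of `straight_4_2`. [plumbing] -/
theorem mem_4_2 : bElem k 4 * symElem k 2 ∈ Submodule.span k
    {x | ∃ (i' : Fin 5) (a : Fin 4 → ℕ), (∑ s, a s) + bDeg i' = bDeg 4 + 1 ∧ x = thetaPow k a * bElem k i'} := by
  rw [straight_4_2]
  exact (Submodule.add_mem _ (Submodule.neg_mem _ (gen_mem k 2 ![0, 0, 0, 1] (bDeg 4 + 1) (by decide))) (gen_mem k 4 ![0, 0, 1, 0] (bDeg 4 + 1) (by decide)))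

/-- Membership form of `straight_4_3`. [plumbing] -/
theorem mem_4_3 : bElem k 4 * symElem k 3 ∈ Submodule.span k
    {x | ∃ (i' : Fin 5) (a : Fin 4 → ℕ), (∑ s, a s) + bDeg i' = bDeg 4 + 1 ∧ x = thetaPow k a * bElem k i'} := by
  rw [straight_4_3]
  exact (Submodule.add_mem _ (Submodule.add_mem _ (Submodule.neg_mem _ (gen_mem k 0 ![0, 0, 1, 1] (bDeg 4 + 1) (by decide))) (gen_mem k 1 ![0, 0, 0, 1] (bDeg 4 + 1) (by decide))) (gen_mem k 4 ![1, 0, 0, 0] (bDeg 4 + 1) (by decide)))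

/-- Membership form of `straight_4_4`. [plumbing] -/
theorem mem_4_4 : bElem k 4 * symElem k 4 ∈ Submodule.span k
    {x | ∃ (i' : Fin 5) (a : Fin 4 → ℕ), (∑ s, a s) + bDeg i' = bDeg 4 + 1 ∧ x = thetaPow k a * bElem k i'} := by
  rw [straight_4_4]
  exact (Submodule.add_mem _ (Submodule.add_mem _ (Submodule.neg_mem _ (gen_mem k 2 ![0, 0, 1, 0] (bDeg 4 + 1) (by decide))) (gen_mem k 3 ![0, 0, 0, 0] (bDeg 4 + 1) (by decide))) (gen_mem k 4 ![0, 1, 0, 0] (bDeg 4 + 1) (by decide)))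

/-- Membership form of `straight_4_5`. [plumbing] -/
theorem mem_4_5 : bElem k 4 * symElem k 5 ∈ Submodule.span k
    {x | ∃ (i' : Fin 5) (a : Fin 4 → ℕ), (∑ s, a s) + bDeg i' = bDeg 4 + 1 ∧ x = thetaPow k a * bElem k i'} := by
  rw [straight_4_5]
  exact (gen_mem k 4 ![0, 0, 0, 1] (bDeg 4 + 1) (by decide))

/-- Membership form of `straight_4_6`. [plumbing] -/
theorem mem_4_6 : bElem k 4 * symElem k 6 ∈ Submodule.span k
    {x | ∃ (i' : Fin 5) (a : Fin 4 → ℕ), (∑ s, a s) + bDeg i' = bDeg 4 + 1 ∧ x = thetaPow k a * bElem k i'} := by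
  rw [straight_4_6]
  exact (gen_mem k 2 ![0, 0, 0, 1] (bDeg 4 + 1) (by decide))

/-- Dispatcher: `bElem i · symElem j ∈ M_{bDeg i + 1}` for all `i, j`. [plumbing] -/
theorem mem_base (i : Fin 5) (j : Fin 7) : bElem k i * symElem k j ∈ Submodule.span k
    {x | ∃ (i' : Fin 5) (a : Fin 4 → ℕ), (∑ s, a s) + bDeg i' = bDeg i + 1 ∧ x = thetaPow k a * bElem k i'} := by
  fin_cases i <;> fin_cases j
  exacts [mem_0_0 k, mem_0_1 k, mem_0_2 k, mem_0_3 k, mem_0_4 k, mem_0_5 k, mem_0_6 k, mem_1_0 k, mem_1_1 k, mem_1_2 k, mem_1_3 k, mem_1_4 k, mem_1_5 k, mem_1_6 k, mem_2_0 k, mem_2_1 k, mem_2_2 k, mem_2_3 k, mem_2_4 k, mem_2_5 k, mem_2_6 k, mem_3_0 k, mem_3_1 k, mem_3_2 k, mem_3_3 k, mem_3_4 k, mem_3_5 k, mem_3_6 k, mem_4_0 k, mem_4_1 k, mem_4_2 k, mem_4_3 k, mem_4_4 k, mem_4_5 k, mem_4_6 k]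

/-- `M_t · symElem j ⊆ M_{t+1}`. [OURS · L1 W4.5a] -/
theorem mul_symElem_mem (t : ℕ) (j : Fin 7) {x : Ring k PEmpty RMonoidDefs.rDatum}
    (hx : x ∈ Submodule.span k {x | ∃ (i : Fin 5) (b : Fin 4 → ℕ), (∑ u, b u) + bDeg i = t ∧ x = thetaPow k b * bElem k i}) :
    x * symElem k j ∈ Submodule.span k
      {x | ∃ (i : Fin 5) (b : Fin 4 → ℕ), (∑ u, b u) + bDeg i = t + 1 ∧ x = thetaPow k b * bElem k i} := by
  induction hx using Submodule.span_induction with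
  | mem x hx =>
    obtain ⟨i, b, hb, rfl⟩ := hx
    have h := thetaPow_mul_mem k b (bDeg i + 1) (mem_base k i j)
    have ht : bDeg i + 1 + ∑ u, b u = t + 1 := by rw [← hb]; ring
    rw [ht, ← mul_assoc] at h
    exact h
  | zero => rw [zero_mul]; exact Submodule.zero_mem _
  | add x y _ _ hx hy => rw [add_mul]; exact Submodule.add_mem _ hx hy
  | smul c x _ hx => rw [smul_mul_assoc]; exact Submodule.smul_mem _ c hx

/-! ## §6 Spanning: every monomial of `k[R]` lies in `Σᵢ k[θ] · bElem i`, degree by degree -/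

/-- ★★ **SPANNING**: every monomial `wordElem (wordOf m)` of `k[R]` of degree `t = Σ m` lies in `M_t = span_k {θ^a · bElem i : |a| + bDeg i = t}`.
Hence `k[R] = Σᵢ k[θ] · bElem i` (the monomials `wordElem (wordOf m)` span `k[R]` over `k`, `…RMonoidFreeBasis`). [OURS · L1 W4.5a] -/
theorem wordElem_wordOf_mem : ∀ (t : ℕ) (m : Fin 7 → ℕ), ∑ j, m j = t →
    wordElem k PEmpty RMonoidDefs.rDatum (wordOf m) ∈ Submodule.span k
      {x | ∃ (i : Fin 5) (a : Fin 4 → ℕ), (∑ s, a s) + bDeg i = t ∧ x = thetaPow k a * bElem k i} := by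
  intro t
  induction t with
  | zero =>
    intro m hm
    have hm0 : m = bMult 0 := by
      funext j
      have : m j = 0 := by
        have h := Finset.sum_eq_zero_iff.mp hm j (Finset.mem_univ j)
        exact h
      rw [this]
      fin_cases j <;> rfl
    have h1 : wordElem k PEmpty RMonoidDefs.rDatum (wordOf m) = thetaPow k 0 * bElem k 0 := by
      rw [thetaPow_zero, one_mul, hm0]; rfl
    rw [h1]
    exact gen_mem k 0 0 0 (by simp [bDeg])
  | succ t ih =>
    intro m hm
    -- some symbol occurs
    obtain ⟨j, hj⟩ : ∃ j, 0 < m j := by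
      by_contra h
      push Not at h
      have : ∑ j, m j = 0 := Finset.sum_eq_zero fun j _ => Nat.le_zero.mp (h j)
      omega
    set m' : Fin 7 → ℕ := m - Pi.single j 1 with hm'
    have hsplit : m = m' + Pi.single j 1 := by
      funext l
      simp only [hm', Pi.add_apply, Pi.sub_apply, Pi.single_apply]
      split_ifs with h
      · subst h; omega
      · omega
    have hsum : ∑ l, m' l = t := by
      have h2 : ∑ l, m l = ∑ l, m' l + ∑ l, (Pi.single j 1 : Fin 7 → ℕ) l := by
        rw [← Finset.sum_add_distrib]; exact Finset.sum_congr rfl fun l _ => by rw [hsplit]; rfl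
      rw [Finset.sum_pi_single'] at h2
      simp only [Finset.mem_univ, if_true] at h2
      omega
    rw [hsplit, wordElem_wordOf_add]
    exact mul_symElem_mem k t j (ih m' hsum)

end Summit.ResolutionOfSingularities.ResolutionOfSingularities.Theorems.FInjectiveMacaulayfication.RMonoidSpanning

end
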